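import Literature.NumberTheory.ModularForms.CohenEisensteinCoefficients
import Literature.NumberTheory.LFunctions.PrimitiveQuadraticCharacterTransport
import Literature.NumberTheory.QuadraticFields.JacobiCharacter
import Summits.BirchSwinnertonDyer.BirchSwinnertonDyer.Theorems.PrintCFramBottomClassIndexLawFiveLeOffLocusDictionary
import HarnessLib

/-!
# Crux `PrintCFram.BottomClassIndexLawFiveLe` (stmt-BirchSwinnertonDyer-20372), line `eisenstein-resource-bdp-line` (registry v23):
# THE COHEN DICTIONARY ON THE `m`-CUT, part 1 — Kronecker-symbol algebra; the class character `χ` and the field character `ε_K`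
# ARE Kronecker characters (`χ = χ_{e*}`, `ε_K = J(· | n₀)`), read in `ℚ_p`
# (cell `bsd-print-cfram`, width seat `bsd-line-cfram-p1-w4` g12; THEOREMS ONLY, `--supports` 20372; BSD is not proved by any of this)

HONEST FRAMING. Nothing here is a statement about BSD or about any curve; no registered stub is closed. Registry v23's
`stub_cutForm` (= (CutForm⁶), the `hcut` binder of `ThetaCycle.atP_six_of_cutForm`, w8 g6 p686877) is a TYPING statement:
the `m`-cut of Cohen's weight-`k + 1/2` Eisenstein series, reduced mod `p`, inside a Katz family, WITH THE DICTIONARY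
«`coeff (m·n₀·f²) G = t · ι x`, `x = k⁻¹ B_k((χ↑ε_K↑)~)`, `t = 1` at `f = 1`» on the cut. That dictionary is item (D5) of the
typing memo (`Cruxes/…/Lines/eisenstein-resource-bdp-line-w8g6-notes.md` §3.1–3.2); with the Cohen numbers `H(k, N)` now a
Literature DEFINITION (`ModularForms/CohenEisensteinCoefficients.lean`, item (D1)) it becomes a THEOREM, proved here in tree
vocabulary — so that what remains of (CutForm⁶) is exactly the three modular-form named facts NF-A (Cohen 1975 Thm 3.1 ×
`θ₀(Q²z)`), NF-C (periodic cut), NF-D (Katz 1973/1977) over the NAMED `q`-series `Σ H(k, a) qᵃ`.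

For a class datum `(p, m, χ, k)` (`χ : DirichletCharacter ℚ_[p] m` PRIMITIVE QUADRATIC, parity `χ(−1)(−1)^k = −1`) and a cut
index `a = m·n₀·f²` (`n₀ ≡ 3 (mod 4)` squarefree, `f ≥ 1`, the cut's Jacobi clauses `J(−n₀f² | q) = 1` at the odd primes
`q ∣ m`), with `K` imaginary quadratic of discriminant `−n₀` and `ε_K` its `ℚ_p`-valued Kronecker character
(`KrizLi2019.IsKroneckerCharacterOf K ε_K`):
* §1 Kronecker-symbol algebra for `CohenEisenstein.chiDisc`: vanishing off the units, multiplicativity `χ_{D₁D₂} = χ_{D₁}χ_{D₂}`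
  (`D₂ ≡ 1 (mod 4)`), the product of a fundamental discriminant with a coprime `−n₀ ≡ 1 (mod 4)` is fundamental.
* §2 **`apply_natCast_eq_chiDisc`** — THE CLASS CHARACTER IS A KRONECKER CHARACTER: `χ(c) = χ_{e*}(c)` for all `c : ℕ`,
  `e* := χ(−1)·m`, and `e*` is a fundamental discriminant or `1` (Montgomery–Vaughan Thm. 9.13, transported to `ℚ_p` values by
  `LFunctions/PrimitiveQuadraticCharacterTransport.lean`).
* §3 `apply_natCast_eq_jacobiSym_of_isKroneckerCharacterOf` — `ε_K(c) = J(c | n₀)` (existence with these values, part K-odd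
  `KrizLiBinders.exists_isKroneckerCharacterOf_of_discr`, + uniqueness `OffLocusDictionary.eq_of_isKroneckerCharacterOf`).
Part 2 (`…CohenCutDictionary`) assembles the level-`m·|d_K|` product `χ↑·ε_K↑`, Cohen's decomposition of the cut index and THE
DICTIONARY `(H(k, m n₀ f²) : ℚ_p) = −T · (k⁻¹ · B_k((χ↑ε_K↑)~))`; part 3 (`…CohenCutIntegrality`) the `p`-integrality.
beyond-print theorem: NO.

References: [Cohen1975] §2 (definition of `H(r, N)`), Thm. 3.1; [MontgomeryVaughan2007] Thm. 9.13; [Cox2013] §1.C Lemma 1.14;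
[KrizLi2019] §2 (p. 12, `ε_K`); [Washington1997] Prop. 4.1, Thm. 4.2; crux notes `Lines/eisenstein-resource-bdp-line-w8g6-notes.md` §3.
-/

set_option autoImplicit false
-- summit-side namespace `Summit.BirchSwinnertonDyer.BirchSwinnertonDyer.…` (single-conjunct summit, D-0017 layout)
set_option linter.dupNamespace false

noncomputable section

open scoped Classical NumberTheorySymbols
open NumberField DirichletCharacter
open Literature.NumberTheory.LFunctions Literature.NumberTheory.LFunctions.PrimitiveQuadratic
  Literature.NumberTheory.ModularForms.CohenEisenstein Literature.NumberTheory.EllipticCurves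
  Literature.NumberTheory.EllipticCurves.KrizLi2019 Literature.NumberTheory.QuadraticFields

namespace Summit.BirchSwinnertonDyer.BirchSwinnertonDyer.Theorems.PrintCFram.CohenCut

open Summit.BirchSwinnertonDyer.BirchSwinnertonDyer.Theorems.PrintCFram

variable {p : ℕ} [hp : Fact p.Prime]

/-! ## §1 Kronecker-symbol algebra -/

/-- `χ_D(c) = 0` when `c` is not prime to `|D|` (`D ≡ 1 (mod 4)` or `4 ∣ D`). [cite: MontgomeryVaughan2007, Thm. 9.13] -/
theorem chiDisc_eq_zero_of_not_coprime {D : ℤ} (hD : D % 4 = 1 ∨ 4 ∣ D) {c : ℕ} (hc : ¬ c.Coprime D.natAbs) :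
    chiDisc D c = 0 := by
  rcases hD with hD | hD
  · haveI : NeZero D.natAbs := ⟨fun h0 => by rw [Int.natAbs_eq_zero] at h0; rw [h0] at hD; norm_num at hD⟩
    rw [chiDisc_of_emod_four_eq_one hD]
    refine jacobiSym.eq_zero_iff_not_coprime.mpr ?_
    rwa [Int.gcd_natCast_natCast]
  · have hD1 : D % 4 ≠ 1 := by omega
    rcases Nat.even_or_odd c with hce | hco
    · exact chiDisc_of_emod_four_ne_one_of_even hD1 hce
    · haveI : NeZero c := ⟨by rintro rfl; exact (Nat.not_even_iff_odd.mpr hco) Even.zero⟩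
      rw [chiDisc_of_emod_four_ne_one_of_odd hD1 hco]
      refine jacobiSym.eq_zero_iff_not_coprime.mpr ?_
      rwa [Int.gcd_eq_natAbs, Int.natAbs_natCast, Nat.gcd_comm]

/-- **Multiplicativity in the discriminant**: `χ_{D₁D₂}(c) = χ_{D₁}(c)·χ_{D₂}(c)` for `D₁ ≡ 1 (mod 4)` or `4 ∣ D₁`, and
`D₂ ≡ 1 (mod 4)` (Jacobi bimultiplicativity; for `4 ∣ D₁` and odd `c` also the reciprocity `J(c | |D₂|) = J(D₂ | c)`).
[cite: MontgomeryVaughan2007, Thm. 9.13] -/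
theorem chiDisc_mul {D₁ D₂ : ℤ} (hD₁ : D₁ % 4 = 1 ∨ 4 ∣ D₁) (hD₂ : D₂ % 4 = 1) (h₁ : D₁ ≠ 0) (c : ℕ) :
    chiDisc (D₁ * D₂) c = chiDisc D₁ c * chiDisc D₂ c := by
  have h₂ : D₂ ≠ 0 := by rintro rfl; norm_num at hD₂
  haveI : NeZero D₁.natAbs := ⟨Int.natAbs_ne_zero.mpr h₁⟩
  haveI : NeZero D₂.natAbs := ⟨Int.natAbs_ne_zero.mpr h₂⟩
  rcases hD₁ with hD₁ | hD₁
  · have h12 : (D₁ * D₂) % 4 = 1 := by rw [Int.mul_emod, hD₁, hD₂]; decide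
    rw [chiDisc_of_emod_four_eq_one h12, chiDisc_of_emod_four_eq_one hD₁, chiDisc_of_emod_four_eq_one hD₂, Int.natAbs_mul,
      jacobiSym.mul_right]
  · have h12 : (D₁ * D₂) % 4 ≠ 1 := by
      have : (D₁ * D₂) % 4 = 0 := Int.emod_eq_zero_of_dvd (dvd_mul_of_dvd_left hD₁ D₂)
      omega
    have hD₁' : D₁ % 4 ≠ 1 := by have := Int.emod_eq_zero_of_dvd hD₁; omega
    rcases Nat.even_or_odd c with hce | hco
    · rw [chiDisc_of_emod_four_ne_one_of_even h12 hce, chiDisc_of_emod_four_ne_one_of_even hD₁' hce, zero_mul]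
    · rw [chiDisc_of_emod_four_ne_one_of_odd h12 hco, chiDisc_of_emod_four_ne_one_of_odd hD₁' hco,
        chiDisc_of_emod_four_eq_one hD₂, jacobiSym_natAbs_eq_of_emod_four_eq_one hD₂ hco, jacobiSym.mul_left]

/-- **`χ_{e*}(c) · J(c | n₀) = χ_{e*·(−n₀)}(c)`** for `e* ≡ 1 (mod 4)` or `4 ∣ e*` (`e* ≠ 0`) and `n₀ ≡ 3 (mod 4)`, at EVERY
`c : ℕ` (`J(· | n₀) = χ_{−n₀}` since `−n₀ ≡ 1 (mod 4)`). [cite: MontgomeryVaughan2007, Thm. 9.13] -/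
theorem chiDisc_mul_jacobiSym {e : ℤ} (he : e % 4 = 1 ∨ 4 ∣ e) (he0 : e ≠ 0) {n₀ : ℕ} (h4 : n₀ % 4 = 3) (c : ℕ) :
    chiDisc e c * J((c : ℤ) | n₀) = chiDisc (e * -(n₀ : ℤ)) c := by
  have hn4 : (-(n₀ : ℤ)) % 4 = 1 := by omega
  rw [chiDisc_mul he hn4 he0 c, chiDisc_of_emod_four_eq_one hn4, Int.natAbs_neg, Int.natAbs_natCast]

/-- **The product of a fundamental discriminant (or `1`) with a coprime `−n₀`, `n₀ ≡ 3 (mod 4)` squarefree, is a fundamental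
discriminant** (the predicate spelled as in `QuadraticFields/FundamentalDiscriminant.lean`). [cite: MontgomeryVaughan2007, Thm. 9.13] -/
theorem isFundamental_mul_neg {e : ℤ}
    (he : e = 1 ∨ (e % 4 = 1 ∧ Squarefree e ∧ e ≠ 1) ∨ (4 ∣ e ∧ (e / 4 % 4 = 2 ∨ e / 4 % 4 = 3) ∧ Squarefree (e / 4)))
    {n₀ : ℕ} (h4 : n₀ % 4 = 3) (hsq : Squarefree n₀) (hcop : e.natAbs.Coprime n₀) :
    let D := e * (-(n₀ : ℤ))
    (D % 4 = 1 ∧ Squarefree D ∧ D ≠ 1) ∨ (4 ∣ D ∧ (D / 4 % 4 = 2 ∨ D / 4 % 4 = 3) ∧ Squarefree (D / 4)) := by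
  intro D
  have hn4 : (-(n₀ : ℤ)) % 4 = 1 := by omega
  have hn0 : n₀ ≠ 0 := by rintro rfl; norm_num at h4
  have hn3 : 3 ≤ n₀ := by omega
  -- squarefree products over `ℕ` through `natAbs`
  have sqf : ∀ {a : ℤ}, Squarefree a → a.natAbs.Coprime n₀ → Squarefree (a * (-(n₀ : ℤ))) := by
    intro a ha hac
    rw [← Int.squarefree_natAbs, Int.natAbs_mul, Int.natAbs_neg, Int.natAbs_natCast]
    exact (Nat.squarefree_mul hac).mpr ⟨Int.squarefree_natAbs.mpr ha, hsq⟩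
  rcases he with rfl | ⟨he4, hesq, he1⟩ | ⟨he4, hem, hesq⟩
  · left
    refine ⟨by simp only [D, one_mul]; exact hn4, by simpa only [D, one_mul] using sqf squarefree_one (by simp), ?_⟩
    simp only [D, one_mul]; omega
  · left
    refine ⟨by simp only [D]; rw [Int.mul_emod, he4, hn4]; decide, sqf hesq hcop, fun hD1 => ?_⟩
    have h := congrArg Int.natAbs hD1
    rw [Int.natAbs_mul, Int.natAbs_neg, Int.natAbs_natCast, Int.natAbs_one] at h
    have : e.natAbs * n₀ ≥ 1 * 3 := Nat.mul_le_mul (Nat.one_le_iff_ne_zero.mpr (by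
      intro h0; rw [h0, zero_mul] at h; exact zero_ne_one h)) hn3
    omega
  · right
    obtain ⟨t, ht⟩ := he4
    have htD : D = 4 * (t * (-(n₀ : ℤ))) := by simp only [D, ht]; ring
    have hdiv : D / 4 = t * (-(n₀ : ℤ)) := by rw [htD, Int.mul_ediv_cancel_left _ four_ne_zero]
    have het : e / 4 = t := by rw [ht, Int.mul_ediv_cancel_left _ four_ne_zero]
    rw [het] at hem hesq
    refine ⟨⟨_, htD⟩, ?_, ?_⟩
    · rw [hdiv, Int.mul_emod, hn4]
      rcases hem with h | h <;> rw [h] <;> decide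
    · rw [hdiv]
      refine sqf hesq (Nat.Coprime.coprime_dvd_left ?_ hcop)
      rw [ht, Int.natAbs_mul]
      exact Dvd.intro_left _ rfl

/-! ## §2 The class character is a Kronecker character -/

/-- **The class datum's `χ` is `χ_{e*}`, `e* = χ(−1)·m`**: for `χ : DirichletCharacter ℚ_[p] m` primitive and quadratic with
`χ(−1) = s ∈ {±1}`, `χ(c) = chiDisc (s·m) c` for EVERY `c : ℕ` (odd `m`: `χ = J(· | m)` on a squarefree `m` and `s·m ≡ 1 (mod 4)`;
even `m`: `4 ∣ m`, `χ(c) = J(sm | c)` at odd `c`, `0` at even `c`). [cite: MontgomeryVaughan2007, Thm. 9.13] -/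
theorem apply_natCast_eq_chiDisc {m : ℕ} [NeZero m] {χ : DirichletCharacter ℚ_[p] m} (hχ : χ.IsPrimitive)
    (hχq : χ.IsQuadratic) {s : ℤ} (hs : χ (-1) = (s : ℚ_[p])) (hs1 : s = 1 ∨ s = -1) (c : ℕ) :
    χ (c : ZMod m) = (chiDisc (s * m) c : ℚ_[p]) := by
  rcases Nat.even_or_odd m with hme | hmo
  · -- even level: `4 ∣ m`
    have h4 : 4 ∣ m := four_dvd_of_isPrimitive_of_charZero hme hχ hχq
    have hsm : (s * m : ℤ) % 4 ≠ 1 := by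
      have : (s * m : ℤ) % 4 = 0 := Int.emod_eq_zero_of_dvd (dvd_mul_of_dvd_right (Int.natCast_dvd_natCast.mpr h4) s)
      omega
    rcases Nat.even_or_odd c with hce | hco
    · rw [chiDisc_of_emod_four_ne_one_of_even hsm hce, Int.cast_zero]
      refine χ.map_nonunit fun hu => ?_
      have hcop := (ZMod.isUnit_iff_coprime c m).mp hu
      have h2 : 2 ∣ Nat.gcd c m := Nat.dvd_gcd (even_iff_two_dvd.mp hce) (even_iff_two_dvd.mp hme)
      rw [hcop] at h2; exact absurd h2 (by norm_num)
    · rw [chiDisc_of_emod_four_ne_one_of_odd hsm hco]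
      exact apply_natCast_eq_jacobiSym_sign_mul_of_charZero hχ hχq hs hs1 hco
  · -- odd level: squarefree, `χ = J(· | m)`, `s·m ≡ 1 (mod 4)`
    have hsq := squarefree_of_isPrimitive_of_isQuadratic_of_charZero hmo hχ hχq
    have hsm : (s * m : ℤ) % 4 = 1 := by
      by_cases hm1 : m = 1
      · subst hm1
        have h1 : χ (-1) = 1 := by rw [show (-1 : ZMod 1) = 1 from Subsingleton.elim _ _, map_one]
        rw [h1] at hs
        have : s = 1 := by exact_mod_cast hs.symm
        rw [this]; decide
      · have h1 : 1 < m := by have := NeZero.ne m; omega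
        rcases isFundamentalDiscriminant_sign_mul_of_charZero hχ hχq hs hs1 h1 with ⟨h, -, -⟩ | ⟨h, -, -⟩
        · exact h
        · exfalso
          have : (4 : ℤ) ∣ m := by
            rcases hs1 with rfl | rfl
            · simpa using h
            · simpa using h
          have : 2 ∣ m := by exact_mod_cast (show (2 : ℤ) ∣ 4 by norm_num).trans this
          exact (Nat.not_even_iff_odd.mpr hmo) (even_iff_two_dvd.mpr this)
    have habs : (s * m : ℤ).natAbs = m := by
      rcases hs1 with rfl | rfl <;> simp
    rw [chiDisc_of_emod_four_eq_one hsm, habs]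
    exact apply_natCast_eq_jacobiSym_of_charZero hmo hsq χ hχ hχq c

/-- **`e* = χ(−1)·m` is a fundamental discriminant or `1`** (Montgomery–Vaughan Thm. 9.13 in `ℚ_p`; `m = 1` gives `e* = 1`).
[cite: MontgomeryVaughan2007, Thm. 9.13] -/
theorem sign_mul_eq_one_or_isFundamental {m : ℕ} [NeZero m] {χ : DirichletCharacter ℚ_[p] m} (hχ : χ.IsPrimitive)
    (hχq : χ.IsQuadratic) {s : ℤ} (hs : χ (-1) = (s : ℚ_[p])) (hs1 : s = 1 ∨ s = -1) :
    (s * m : ℤ) = 1 ∨ ((s * m : ℤ) % 4 = 1 ∧ Squarefree (s * m : ℤ) ∧ (s * m : ℤ) ≠ 1) ∨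
      (4 ∣ (s * m : ℤ) ∧ ((s * m : ℤ) / 4 % 4 = 2 ∨ (s * m : ℤ) / 4 % 4 = 3) ∧ Squarefree ((s * m : ℤ) / 4)) := by
  by_cases hm1 : m = 1
  · subst hm1
    have h1 : χ (-1) = 1 := by rw [show (-1 : ZMod 1) = 1 from Subsingleton.elim _ _, map_one]
    rw [h1] at hs
    have : s = 1 := by exact_mod_cast hs.symm
    left; rw [this]; simp
  · have h1 : 1 < m := by have := NeZero.ne m; omega
    right; exact isFundamentalDiscriminant_sign_mul_of_charZero hχ hχq hs hs1 h1

/-- `e* = χ(−1)·m` satisfies `e* ≡ 1 (mod 4)` or `4 ∣ e*`, and `e* ≠ 0`. [cite: MontgomeryVaughan2007, Thm. 9.13] -/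
theorem sign_mul_emod_four {m : ℕ} [NeZero m] {χ : DirichletCharacter ℚ_[p] m} (hχ : χ.IsPrimitive) (hχq : χ.IsQuadratic)
    {s : ℤ} (hs : χ (-1) = (s : ℚ_[p])) (hs1 : s = 1 ∨ s = -1) :
    ((s * m : ℤ) % 4 = 1 ∨ 4 ∣ (s * m : ℤ)) ∧ (s * m : ℤ) ≠ 0 := by
  refine ⟨?_, mul_ne_zero (by rcases hs1 with rfl | rfl <;> norm_num) (by exact_mod_cast NeZero.ne m)⟩
  rcases sign_mul_eq_one_or_isFundamental hχ hχq hs hs1 with h | ⟨h, -, -⟩ | ⟨h, -, -⟩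
  · left; rw [h]; decide
  · exact Or.inl h
  · exact Or.inr h

/-! ## §3 The Kronecker character of `K = ℚ(√−n₀)` has the Jacobi values `J(· | n₀)` -/

/-- **`ε_K(c) = J(c | n₀)` for every `c : ℕ`**, for `K` quadratic of discriminant `−n₀` (`n₀ ≡ 3 (mod 4)` squarefree) and any
`ε_K` with `IsKroneckerCharacterOf K ε_K` (existence of such a character WITH these values, part K-odd; uniqueness, w3 g7).
[cite: KrizLi2019, §2 (p. 12, ε_K)] [cite: Cox2013, §1.C Lemma 1.14] -/
theorem apply_natCast_eq_jacobiSym_of_isKroneckerCharacterOf {K : Type} [Field K] [NumberField K]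
    (hK2 : Module.finrank ℚ K = 2) {n₀ : ℕ} (hsq : Squarefree n₀) (h4 : n₀ % 4 = 3) (hdisc : NumberField.discr K = -(n₀ : ℤ))
    {εK : DirichletCharacter ℚ_[p] (NumberField.discr K).natAbs} (hεK : IsKroneckerCharacterOf K εK) (c : ℕ) :
    εK (c : ZMod (NumberField.discr K).natAbs) = (J((c : ℤ) | n₀) : ℚ_[p]) := by
  obtain ⟨ε, hε, hvals⟩ := KrizLiBinders.exists_isKroneckerCharacterOf_of_discr (p := p) hK2 hsq (Or.inr ⟨hdisc, h4⟩)
  rw [OffLocusDictionary.eq_of_isKroneckerCharacterOf hεK hε]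
  exact hvals c

end Summit.BirchSwinnertonDyer.BirchSwinnertonDyer.Theorems.PrintCFram.CohenCut

end
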